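import Mathlib
import Summits.NavierStokesRegularity.NavierStokesRegularity.Theorems.SubOnsagerCeilingKPSideBranchClassTenEnvelopes
import Summits.NavierStokesRegularity.NavierStokesRegularity.Theorems.SubOnsagerCeilingKPSideBranchClassCeiling
import Summits.NavierStokesRegularity.NavierStokesRegularity.Theorems.SubcriticalEnvelopeForwardSourceTailEnvelopeKPSShellBarrier
import HarnessLib

/-!
# `ForwardTailCeilingKP` HOLDS ON THE SIDE-BRANCH CLASS (halved pump) at every scale ratio `1 + ε₀ ∈ [1.78, 2]`
(rung under crux stmt-NavierStokesRegularity-27057 `SubOnsagerCeiling.ForwardTailCeilingKP`, `--supports … --as helper`;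
LEAD SOC census v9 §G.1 / tenure successor item (1) «RUNG 5 on b ∈ [1.78, 2] with D̄ = 1/10»)

Sibling of `SubOnsagerCeilingKPSideBranchClassCeiling` (LEAD g5: `ε₀ ∈ [9/10, 1]`, weights `13P² < f²κ⁴`,
`5Pκ(1+ε₀)^{5/2} ≤ c₀(1+ε₀)^{2θ}`, `P(1+ε₀)^{5/2} ≤ 2c₀(1+ε₀)^{2θ}`). THE CLASS here: the same architecture (chain
`0 → 0` weight `c₀ > 0`, in-shell pump `0 → 1` weight `P ≥ 0`, exit feed `1 → 2` weight `f > 0` into the DEAD-END pocket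
`2`) with weights in the HALVED range `13P² < f²κ⁴`, `10Pκ(1+ε₀)^{5/2} ≤ c₀(1+ε₀)^{2θ}`, `P(1+ε₀)^{5/2} ≤ c₀(1+ε₀)^{2θ}`
for some `κ > 0` (`θ = 101/200`; e.g. `c₀ = f = κ = 1`, `P ≤ 3/100`) — and the WIDER ratio range `ε₀ ∈ [39/50, 1]`.

RESULT (`sideClass_fwdCeilingKP_ten`): for such a table and every `ε₀ ∈ [39/50, 1]` the per-table body of the crux
`ForwardTailCeilingKP` holds with `S = {0, 1}`, `θ = 101/200 > 1/2` and an explicit `C`. Proof: `sideClass_envelopes_ten`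
+ senv-p1's geometric glue `sTailCeiling_of_sShellBarrier_solutions`, exactly as in the sibling.

HONEST: a RUNG (one architecture class, weights in a smallness range, scale ratios `b ≥ 1.78`), not the crux; the union
with the sibling is {pump slack 1/5} × [1.9, 2] ∪ {pump slack 1/10} × [1.78, 2]. MODEL lattice only; nothing here bears
on Navier–Stokes regularity; 27057 stays OPEN.
-/

noncomputable section

-- the sub-problem namespace `NavierStokesRegularity.NavierStokesRegularity` is the tree's layout (D-0017)
set_option linter.dupNamespace false

namespace Summit.NavierStokesRegularity.NavierStokesRegularity.Theorems

open Set Filter Topology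
open Literature.Analysis.FluidPDE.TaoCascade

/-- **`ForwardTailCeilingKP` ON THE SIDE-BRANCH CLASS (halved pump), `1 + ε₀ ∈ [1.78, 2]`** (see the module
docstring): the per-table body of the crux with `S = {0,1}`, `θ = 101/200`. MODEL lattice statement. [this file] -/
theorem sideClass_fwdCeilingKP_ten (R : ℝ) {ε₀ c₀ P f κ : ℝ} (hε : 39 / 50 ≤ ε₀) (hε1 : ε₀ ≤ 1)
    {α : Fin 4 → Fin 4 → Fin 4 → ℤ × ℤ × ℤ → ℝ}
    (hw : ∀ a c : Fin 4, α a a c (0, 0, 1) = (if a = 0 ∧ c = 0 then c₀ else 0) + (if a = 1 ∧ c = 2 then f else 0))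
    (hP : ∀ a c : Fin 4, a ≠ c → α a a c (0, 0, 0) = if a = 0 ∧ c = 1 then P else 0)
    (hCz : ∀ a b c : Fin 4, a ≠ b → a ≠ c → b ≠ c → α a b c (0, 0, 0) = 0)
    (hc₀ : 0 < c₀) (hP0 : 0 ≤ P) (hf : 0 < f) (hκ : 0 < κ)
    (hpair : 13 * P ^ 2 < f ^ 2 * κ ^ 4)
    (hdrain : 10 * P * κ * (1 + ε₀) ^ ((5 : ℝ) / 2) ≤ c₀ * ((1 + ε₀) ^ ((101 : ℝ) / 200)) ^ 2)
    (hP1 : P * (1 + ε₀) ^ ((5 : ℝ) / 2) ≤ c₀ * ((1 + ε₀) ^ ((101 : ℝ) / 200)) ^ 2) :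
    Literature.Analysis.FluidPDE.TaoCascade.InTableClass R α →
    (∀ (Y : Fin 4 → ℤ → ℝ → ℝ) (τ : ℝ), (∀ (j : Fin 4) (k : ℤ), 1 ≤ k → 0 ≤ Y j k τ) → ∀ δ : ℝ, 0 < δ →
      ∀ (i : Fin 4) (n : ℤ), 1 ≤ n → Y i n τ = 0 → 0 ≤ quadTerm δ α Y i n τ) →
    (∀ a b i : Fin 4, a ≠ b → α a b i (0, 0, 1) = 0) →
    ∃ S : Finset (Fin 4), (∀ i, i ∉ S → ∀ j l : Fin 4, α i j l (0, 0, 1) = 0) ∧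
      ∃ θ : ℝ, 1 / 2 < θ ∧ ∃ C : ℝ, 0 ≤ C ∧ ∀ ν : ℝ, 0 < ν → ∀ (X₀ : Fin 4 → ℝ) (s : ℝ), 0 < s →
        ∀ X : Fin 4 → ℤ → ℝ → ℝ, (∀ (i : Fin 4) (k : ℤ), X i k 0 = if k = 0 then X₀ i else 0) →
        (∀ (i : Fin 4) (k : ℤ), k < 0 → ∀ t : ℝ, X i k t = 0) →
        (∃ M : ℝ, ∀ (t : ℝ) (i : Fin 4) (k : ℤ), (1 + (1 + ε₀) ^ ((10 : ℝ) * k)) * |X i k t| ≤ M) →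
        (∀ (i : Fin 4) (k : ℤ), Continuous (X i k)) →
        (∀ (i : Fin 4) (k : ℤ), ∀ t ∈ Set.Icc (0 : ℝ) s, HasDerivWithinAt (X i k)
          (quadTerm ε₀ α X i k t - ν * (1 + ε₀) ^ ((2 : ℝ) * k) * X i k t) (Set.Icc (0 : ℝ) s) t) →
        (∀ t ∈ Set.Icc (0 : ℝ) s, ∀ (i : Fin 4) (k : ℤ), 1 ≤ k → 0 ≤ X i k t) →
        ∀ n N : ℕ, n ≤ N → ∀ t ∈ Set.Icc (0 : ℝ) s,
          ∑ k ∈ Finset.Icc n N, ∑ i ∈ S, (1 / 2 : ℝ) * X i (k : ℤ) t ^ 2 ≤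
            C * (∑ i : Fin 4, (1 / 2 : ℝ) * X₀ i ^ 2) * (1 + ε₀) ^ (-(2 * θ * (n : ℝ))) := by
  intro hT hO hD
  obtain ⟨hsy, hc, _⟩ := hT
  have hε0 : 0 < ε₀ := by linarith
  have hb0 : (0 : ℝ) < 1 + ε₀ := by linarith
  refine ⟨{0, 1}, sideClass_sources hD hw, 101 / 200, by norm_num, ?_⟩
  -- the weighted per-mode barrier on `S = {0,1}` with `D = 101 + 100κ²`
  have H : ∀ ν : ℝ, 0 < ν → ∀ (X₀ : Fin 4 → ℝ) (s : ℝ), 0 < s → ∀ X : Fin 4 → ℤ → ℝ → ℝ,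
      (∀ (i : Fin 4) (k : ℤ), X i k 0 = if k = 0 then X₀ i else 0) →
      (∀ (i : Fin 4) (k : ℤ), k < 0 → ∀ t : ℝ, X i k t = 0) →
      (∃ M : ℝ, ∀ (t : ℝ) (i : Fin 4) (k : ℤ), (1 + (1 + ε₀) ^ ((10 : ℝ) * k)) * |X i k t| ≤ M) →
      (∀ (i : Fin 4) (k : ℤ), Continuous (X i k)) →
      (∀ (i : Fin 4) (k : ℤ), ∀ t ∈ Icc (0 : ℝ) s, HasDerivWithinAt (X i k)
        (quadTerm ε₀ α X i k t - ν * (1 + ε₀) ^ ((2 : ℝ) * k) * X i k t) (Icc (0 : ℝ) s) t) →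
      (∀ t ∈ Icc (0 : ℝ) s, ∀ (i : Fin 4) (k : ℤ), 1 ≤ k → 0 ≤ X i k t) →
      ∀ t ∈ Icc (0 : ℝ) s, ∀ i ∈ ({0, 1} : Finset (Fin 4)), ∀ k : ℕ,
        (1 + ε₀) ^ (2 * (101 / 200 : ℝ) * (k : ℝ)) * ((1 / 2 : ℝ) * X i (k : ℤ) t ^ 2) ≤
          (101 + 100 * κ ^ 2) * (∑ j : Fin 4, (1 / 2 : ℝ) * X₀ j ^ 2) := by
    intro ν hν X₀ s hs X hX0 hvan hbdd hXc hode hnn t ht i hi k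
    obtain ⟨M, hM⟩ := hbdd
    set E₀ : ℝ := ∑ j : Fin 4, (1 / 2 : ℝ) * X₀ j ^ 2 with hE₀
    have hE₀0 : 0 ≤ E₀ := Finset.sum_nonneg fun j _ => by positivity
    have henv := sideClass_envelopes_ten hε hε1 hν hs hsy hc hO hD hw hP hCz hc₀ hP0 hf hκ hpair hdrain hP1
      hX0 hvan ⟨M, hM⟩ hXc hode hnn t ht
    -- the weight as a natural power
    have hwt : (1 + ε₀) ^ (2 * (101 / 200 : ℝ) * (k : ℝ)) = ((1 + ε₀) ^ ((101 : ℝ) / 200)) ^ (2 * k) := by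
      rw [← Real.rpow_mul_natCast hb0.le]; congr 1; push_cast; ring
    rw [hwt]
    have hmode := sideClass_mode_le_energy hε0 hν hc hX0 hvan hM hode ht i k
    simp only [Finset.mem_insert, Finset.mem_singleton] at hi
    rcases hi with rfl | rfl
    · -- the chain component
      have h := henv.1 k
      nlinarith [sq_nonneg κ]
    · -- the side source
      rcases Nat.eq_zero_or_pos k with hk0 | hk
      · subst hk0
        simp only [Nat.cast_zero, mul_zero, pow_zero, one_mul]
        nlinarith [sq_nonneg κ]
      · have h := henv.2 k hk
        nlinarith [sq_nonneg κ]
  obtain ⟨C, hC0, hC⟩ := sTailCeiling_of_sShellBarrier_solutions (α := α) hε0 (by norm_num : (0 : ℝ) < 101 / 200)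
    (by positivity : (0 : ℝ) ≤ 101 + 100 * κ ^ 2) ({0, 1} : Finset (Fin 4)) H
  exact ⟨C, hC0, hC⟩

end Summit.NavierStokesRegularity.NavierStokesRegularity.Theorems

end
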